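import Summits.BirchSwinnertonDyer.BirchSwinnertonDyer.Theorems.ResidualThetaTransportAtTwoThetaLayerLambdaCongruenceAtTwoOfSdBzNode
import Summits.BirchSwinnertonDyer.BirchSwinnertonDyer.Theorems.ResidualThetaTransportAtTwoCuspSpanEvenAtTwoOdd
import HarnessLib

/-!
# Crux Kan⁺ `ThetaLayerLambdaCongruenceAtTwo` (stmt-BirchSwinnertonDyer-20688), line `birth`: the crux BY NAME from TWO print facts
# {Hecke self-duality of `J₀(N)[ℓ]`, Buzzard 2000 Prop. 2.4} ALONE — the node is now a theorem at every odd level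

Cell `bsd-wall`, width seat `bsd-wall-rtt-p3-w3` g9 (`--supports stmt-BirchSwinnertonDyer-20688`; THEOREMS ONLY — no `def`, no named
fact, no `sorry`). BSD is not proved by this; every theorem below is CONDITIONAL on the displayed print facts (held, cite-level published
theorems, never prover targets), and nothing here closes an item.

STATE OF RECORD BEFORE THIS FILE.
* `…ThetaLayerLambdaCongruenceAtTwoOfSdBzNode` (this seat, p643583): `thetaLayerLambdaCongruenceAtTwo_of_sdBz_cuspSpanEvenAtTwoOdd :
  SD → Bz → CuspSpanEvenAtTwoOdd → Kan⁺` — Abbes–Ullmo, the assembled Eichler–Shimura fact and Serre 1972 are idle for Kan⁺.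
* `…ResidualThetaTransportAtTwoCuspSpanEvenAtTwoOdd` (width seat rtt-p3-w2 g5, p643713, over `…CuspSpanRowInductionOdd` p643326 and
  rtt-p3-w4 g2's all-odd-rows induction p640615 → p640993 → p641782 → p642344, p642718): `CuspSpanEvenAtTwoOdd_proof :
  CuspSpanEvenAtTwoOdd` — the route's node item 27436 («`SignedMuAtTwo.CuspSpanEvenAtTwo N` at EVERY odd level `N`») is CLOSED·proved
  (2026-08-28T15:07Z), unconditionally.
THIS FILE feeds the second into the first:
* `thetaLayerLambdaCongruenceAtTwo_of_sdBz (hSD) (hBz) : ThetaLayerLambdaCongruenceAtTwo` — **the crux from PUB² alone**; curried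
  binder list `kanP2_of_pub : SD → Bz → Kan⁺`;
* `thetaLayerLambdaCongruenceAtTwo_of_ipBz` — SD replaced by the Hecke-self-adjoint perfect pairing on `H₁(X₀(N); ℤ)` (IP), through the
  landed reduction `heckeSelfDual_torsionBy_J0_of_perfectPairing`;
* `thetaLayerLambdaCongruenceAtTwo_of_aliasInputs (h27800) (h27798)` — from the two single-fact alias ITEMS 27800 `HeckeSelfDualTorsionJ0Input`,
  27798 `BuzzardMultiplicityOneGammaZeroInput` (route declarations only);
* `thetaLayerLambdaCongruenceAtTwo_of_pub (hPUB : PublishedInputsHeckeAtTwo)` — from the bundle item 27435 ALONE (conjuncts `.2.1`, `.2.2.1`;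
  ES `.1`, Se `.2.2.2.1`, AU `.2.2.2.2` untouched): the `closes` recipe «Kan⁺ ⟸ 27435» as one term.
PLANNER READING: after the node, the ENTIRE open content of crux 20688 is the print pair {SD (⟸ IP, landed), Bz}; AU matters only for the
Néron-normalised sibling item 21437. Trust base of `thetaLayerLambdaCongruenceAtTwo_of_ipBz`: {`w_N`-twisted intersection pairing on
`H₁(X₀(N); ℤ)` (Merel 1995 / DDT Lemma 1.38), Buzzard 2000 Prop. 2.4}.

References: Greenberg–Vatsal, Invent. Math. 142 (2000) §1 (10), Prop. (2.4) [GreenbergVatsal2000]; R. Pollack, Duke Math. J. 118 (2003)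
Conj. 6.3, Prop. 6.18 [Pollack2003]; K. Buzzard, MRL 7 (2000) Prop. 2.4 [Buzzard2000LevelLoweringModTwo]; Darmon–Diamond–Taylor (1995)
§1.6 Lemma 1.38, §4.5 [DarmonDiamondTaylor1995]; L. Merel (1995) §1.2–2.3 [Merel1995Homologie].
-/

set_option autoImplicit false
-- justification: the `Summit.BirchSwinnertonDyer.BirchSwinnertonDyer.…` path repeats a component (route-file convention)
set_option linter.dupNamespace false

noncomputable section

open Literature.NumberTheory.EllipticCurves.ModularForms
  Summit.BirchSwinnertonDyer.BirchSwinnertonDyer.Theses.ResidualThetaTransportAtTwo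

namespace Summit.BirchSwinnertonDyer.BirchSwinnertonDyer.Theorems.ThetaLayerLambdaCongruenceAtTwo

/-- **Kan⁺ `ThetaLayerLambdaCongruenceAtTwo` BY NAME from TWO print facts {SD, Bz} alone.** The node hypothesis of
`thetaLayerLambdaCongruenceAtTwo_of_sdBz_cuspSpanEvenAtTwoOdd` is discharged by the item's closer `CuspSpanEvenAtTwoOdd_proof` (rtt-p3-w2 g5
over rtt-p3-w4 g2's all-odd-rows induction; item 27436 CLOSED·proved). Conditional on the two print facts (Hecke self-duality of
`J₀(N)[ℓ]`, Buzzard 2000 Prop. 2.4); BSD is not proved by this.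
[cite: GreenbergVatsal2000, §1 (10) and Prop. (2.4) (shape)] [cite: Pollack2003, Conj. 6.3 and Prop. 6.18]
[cite: Buzzard2000LevelLoweringModTwo, Prop. 2.4] [cite: DarmonDiamondTaylor1995, §1.6 Lemma 1.38 and §4.5] -/
theorem thetaLayerLambdaCongruenceAtTwo_of_sdBz
    (hSD : heckeSelfDual_torsionBy_J0) (hBz : buzzard2000_multiplicityOne_gamma0) : ThetaLayerLambdaCongruenceAtTwo :=
  thetaLayerLambdaCongruenceAtTwo_of_sdBz_cuspSpanEvenAtTwoOdd hSD hBz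
    Summit.BirchSwinnertonDyer.BirchSwinnertonDyer.Theorems.CuspSpanEvenAtTwoOdd_proof

/-- **Curried binder list «KanP2»**: Hecke self-duality, Buzzard, then the crux — all BY NAME; no item hypothesis remains.
[cite: Pollack2003, Prop. 6.18 (shape)] -/
theorem kanP2_of_pub :
    heckeSelfDual_torsionBy_J0 → buzzard2000_multiplicityOne_gamma0 → ThetaLayerLambdaCongruenceAtTwo :=
  thetaLayerLambdaCongruenceAtTwo_of_sdBz

/-- **Integral form**: Kan⁺ BY NAME from the Hecke-self-adjoint perfect pairing on the period homology `H₁(X₀(N); ℤ)`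
(`periodHomology_exists_heckeSelfAdjoint_perfectPairing`, the `w_N`-twisted intersection pairing) and Buzzard 2000 Prop. 2.4; the
mod-`ℓ` self-duality is DERIVED (`heckeSelfDual_torsionBy_J0_of_perfectPairing`). Conditional on these two print facts; BSD is not
proved by this. [cite: Merel1995Homologie, §1.2–1.3 and §2.1–2.3] [cite: DarmonDiamondTaylor1995, §1.6 Lemma 1.38 and §4.5]
[cite: Buzzard2000LevelLoweringModTwo, Prop. 2.4] -/
theorem thetaLayerLambdaCongruenceAtTwo_of_ipBz
    (hIP : periodHomology_exists_heckeSelfAdjoint_perfectPairing) (hBz : buzzard2000_multiplicityOne_gamma0) :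
    ThetaLayerLambdaCongruenceAtTwo :=
  thetaLayerLambdaCongruenceAtTwo_of_sdBz (heckeSelfDual_torsionBy_J0_of_perfectPairing hIP) hBz

/-- **Kan⁺ BY NAME from the two single-fact alias ITEMS** 27800 `HeckeSelfDualTorsionJ0Input` and 27798
`BuzzardMultiplicityOneGammaZeroInput` (route declarations only; no bundle, no node hypothesis). Conditional on two held print facts;
BSD is not proved by this. [cite: DarmonDiamondTaylor1995, §1.6 Lemma 1.38 and §4.5] [cite: Buzzard2000LevelLoweringModTwo, Prop. 2.4] -/
theorem thetaLayerLambdaCongruenceAtTwo_of_aliasInputs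
    (h27800 : HeckeSelfDualTorsionJ0Input) (h27798 : BuzzardMultiplicityOneGammaZeroInput) : ThetaLayerLambdaCongruenceAtTwo :=
  thetaLayerLambdaCongruenceAtTwo_of_sdBz h27800 h27798

/-- **Kan⁺ BY NAME from the PUB⁵ bundle item 27435 `PublishedInputsHeckeAtTwo` ALONE** — only the conjuncts SD (`.2.1`) and Bz
(`.2.2.1`) are used; ES (`.1`), Se (`.2.2.2.1`) and AU (`.2.2.2.2`) are idle. This is the `closes` reading «20688 ⟸ 27435» as one term
(the node child 27436 being a theorem). Conditional on the bundle's print facts; BSD is not proved by this. [cite: Pollack2003, Prop. 6.18 (shape)] -/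
theorem thetaLayerLambdaCongruenceAtTwo_of_pub (hPUB : PublishedInputsHeckeAtTwo) : ThetaLayerLambdaCongruenceAtTwo :=
  thetaLayerLambdaCongruenceAtTwo_of_sdBz hPUB.2.1 hPUB.2.2.1

end Summit.BirchSwinnertonDyer.BirchSwinnertonDyer.Theorems.ThetaLayerLambdaCongruenceAtTwo

end
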